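import Mathlib
import HarnessLib
import HarnessLib.Audit
import Summits.HubbardSuperconductivity.Statement
import Literature.MathematicalPhysics.QuantumLattice.GaugedHubbardTorus
import HarnessLib.Audit.Status.Attr

/-!
Route: ColourTheSpin

CLOSED (refuted) 2026-08-17T14:34:48Z by planner-rfix-HubbardSuperconductivity-Colour-50e50438-0 — reason: refuted:stmt-HubbardSuperconductivity-16273 (SgAnchorOrder) by Summit.HubbardSuperconductivity.HubbardSuperconductivity.Theorems.ColourTheSpinSgAnchorOrder_refuted — note: route-repair (planner-rfix-…-50e50438-0): CLOSED per the header's own KILL CRITERIA — SgAnchorOrder (stmt-16273, the strong-coupling anchor, ∃(U,δ) form) refuted in tree by Theorems.ColourTheSpinSgAnchorOrder_refuted @ e05657dafcf5 (electric freezing as g→∞ on the quantified half-line + flux ultralo. The file is kept as the record of this route; refuted decls are indexed as negative knowledge (`ledger negatives`).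

# Route ColourTheSpin — gauge the spin by a removable Q8 link field — Elitzur deletes spin
competitors, confinement glues singlet pairs, return g→0

It suffices to show X := SgCorridorOrder ∧ SgEndpoint, reached through SgAnchorOrder and SgCorridor
: SgAnchorOrder → SgCorridorOrder (realises idea card colour-the-spin-two-colour-qcd, audited
new-combination ×4, unrouted during the planning freeze; this seat's modifications: FINITE gauge
group, all-Gauss-sector every-GS typing, explicit dictionary supports). OBJECT (inlined verbatim in
every item, no new constant): the Q8-SPIN-GAUGED HUBBARD TORUS H_g(L,U) on the basis (occupation
configuration of hubbardTorus 2 L 1 U) × (link configuration k : Bond L → Q8), Q8 = ⟨a, x | a⁴ = 1,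
x² = a², xax⁻¹ = a⁻¹⟩ ⊂ SU(2) coded as Fin 2 × ZMod 4 with its faithful spin-½ representation ρ(aⁱ)
= diag(iⁱ, (−i)ⁱ), ρ(x aⁱ) = [[0, −(−i)ⁱ],[iⁱ, 0]]: H_g = −Σ_(b=(x,i)) Σ_(σ,τ) (c†_(xσ) ρ(k b)_(στ)
c_(x+eᵢ,τ) ⊗ 1 + h.c.) + U Σ_x n_(x↑)n_(x↓) ⊗ 1 + g² · 1 ⊗ Σ_b E_b + g⁻² · 1 ⊗ Σ_p (1 − ½ tr
ρ(hol_p)), E_b = projector onto link wave-functions orthogonal to the constant (zero-flux) function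
of u_b, hol_p the plaquette holonomy; electrons keep (t, U, N_L) of the summit verbatim and only
their SPIN is minimally coupled. ORDER PARAMETER: the gauge-INVARIANT B1g singlet pair field Δ_d^g =
Σ_b g_d(b) Σ_(σ,τ) (ε ρ(k b))_(στ) c_(xσ) c_(x+eᵢ,τ) (ρᵀ ε ρ = ε since det ρ = 1), equal at trivial
links to the summit's Δ_d = pairField dWaveFormFactor L /√2 (support SgPairDictionary). X is reached
in three steps: (K1 = SgAnchorOrder) at some (U, δ) and all STRONG gauge couplings g ≥ g₀ every
ground state of the N_L-particle block of H_g (N_L = 2⌊(1−δ)L²/2⌋, all Gauss sectors admitted, even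
L ≥ L₀) has ⟨Δ_d^g† Δ_d^g⟩ ≥ c L⁴ — the confined end, where every spin-carrying excitation costs g²
and the only mobile charged objects are gauge-singlet charge-2e pairs (bond singlets ↔ doublons,
mobile at first order in t through the doublon, cost U); (K1′ = SgCorridor : SgAnchorOrder →
SgCorridorOrder) that order persists with one constant c′ > 0 down the whole corridor g ∈ (0, g₀]
(SgCorridorOrder, the rank-0 target, is corridor order at some point and stays attackable directly);
(K2 = SgEndpoint, the bet) order uniform on (0, g₀] forces the summit's matrix at (U, δ): as g → 0⁺
the magnetic weight g⁻² Σ_p (1 − ½ tr ρ(hol_p)) pins the links EXACTLY to flat Q8 connections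
(finite group: flatness is an equation, not a limit), the g → 0⁺ physical space is a finite direct
sum of Q8-spin-twisted Hubbard tori, and the electric term g² Σ E_b selects the gauge-averaged
zero-twist sector, whose fermion factor is hubbardTorus 2 L 1 U itself (support
SgHoppingDictionary).
Lean: `SgCorridorOrder ∧ SgEndpoint`

## Assembly
Pure logic (theorem `closes` in glue.lean, kernel-checked sorry-free in the planner's Sketch.lean,
lean check rc 0): SgCorridor applied to SgAnchorOrder gives SgCorridorOrder, i.e. (U, δ, g₀, c′, L₁)
with 0 < U, δ ∈ Ioo 0 (1/2), 0 < g₀, 0 < c′ and corridor order on (0, g₀]; SgEndpoint applied to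
exactly that clause gives the summit's matrix at (U, δ); hence ∃ U > 0, ∃ δ ∈ Ioo 0 (1/2), matrix —
literally `HubbardSuperconductivity` (Iff.rfl with
Literature.Hubbard.DWaveSuperconductivityHubbard). All three cruxes are hypotheses of `closes` and
the target is the type of `SgCorridor SgAnchorOrder`; the two supports certify the dictionary and
are not hypotheses of `closes`.

Rationale: WHY THIS LINE. For every g > 0 the local Q8 gauge symmetry deletes, by ELITZUR's theorem
(doi:10.1103/physrevd.12.3978; Hamiltonian form: group-averaging over the local gauge group, whose
spin image V₄ ⊂ SO(3) has no invariant vector — checked: Σ_(u∈Q8) R(u) = 0), every spin-VECTOR order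
parameter of the pure model at once — Néel, spiral, spin stripes, Nagaoka ferromagnetism, i.e.
exactly the competitors the stripe barrier names at t′ = 0 (arXiv:1910.08931, arXiv:2303.08376) —
while the singlet pair field stays a LOCAL gauge-invariant operator, so pairing order itself is not
obstructed; at strong coupling confinement (Kogut–Susskind doi:10.1103/physrevd.11.395;
Osterwalder–Seiler/Fradkin–Shenker doi:10.1103/physrevd.19.3682) turns the compressible charged
sector into even-charge bosons, so pairing is kinematic rather than an e^(−1/U²) instability, and
the strong-coupling end is where rigorous SSB technology for gauge–fermion systems exists
(Salmhofer–Seiler doi:10.1007/bf02352501, RP + infrared bounds; sign-free two-colour-QCD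
dimer–baryon representations doi:10.1103/physrevd.74.014506, diquark condensation
doi:10.1016/s0550-3213(00)00242-x). Imported areas: Hamiltonian lattice gauge theory (Elitzur,
confinement, Born–Oppenheimer holonomy reduction), two-colour QCD at finite density (explicit
dictionary: spin ↦ colour, singlet Cooper pair ↦ baryon = boson for N_c = 2, hole doping ↦ μ_B),
finite-group gauge theory (exact flat sector). What no listed route does: EatTheGoldstone gauges the
CHARGE U(1) to Higgs the condensate into Z₂ topological order and returns through energies; every
anchor route (PlaquetteBoson, SpinOnePairBoson, CooperPairDMottWalk, RvbParentAnchor, SpNLargeN)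
deforms the electrons' hopping pattern or interaction; here (t, U, δ, lattice symmetries, charge
U(1) and its Goldstone mode) are untouched along the whole path and the competitors are removed by a
theorem instead of by aiming; the negatives index (KlsOrderOpenness: U(1)-covariant perturbations
wind XY order) is respected because a SPIN gauge background cannot wind the charge-2e singlet
condensate.

RANKED CRUXES. #0 SgCorridorOrder (target) — CORRIDOR ORDER (the X consumed by the endpoint crux):
there are U > 0, δ ∈ (0,1/2), g₀ > 0, c′ > 0, L₁ such that for every gauge coupling g ∈ (0, g₀] and
every even L ≥ L₁ every ground state ψ of the N_L-particle block of the Q8-spin-gauged torus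
H_g(L,U) (all Gauss sectors admitted; ground state = nonzero eigenvector whose eigenvalue lies below
every Rayleigh quotient of the block) has gauged B1g pair order c′·L⁴·‖ψ‖² ≤ ⟨ψ, Δ_d^g†Δ_d^g ψ⟩.
Reached as SgCorridor ∘ SgAnchorOrder; attackable directly. [difficulty: open-problem] (why it might
fail: it contains the whole bet on the gauged side: an empty B1g corridor (A1g/VBS/phase separation
at strong g) or loss of order across the Q8 deconfinement crossing makes it false at every (U,δ).)
[doi:10.1103/physrevd.11.395, doi:10.1103/physrevd.19.3682, doi:10.1007/bf02352501]
#2 SgEndpoint (crux) — ENDPOINT CONTINUITY (card K2, the load-bearing bet), pointwise in (U, δ): for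
all U > 0, δ ∈ (0,1/2), g₀ > 0, c′ > 0, L₁: if for every g ∈ (0, g₀] and every even L ≥ L₁ every
ground state of the N_L-block of H_g(L,U) has gauged B1g pair order ≥ c′L⁴‖ψ‖², then every
normalised (N_L, S^z = 0)-sector ground-state sequence of hubbardTorus 2 L 1 U has d_(x²−y²)
pair-field long-range order along even L (the summit's matrix at (U, δ), verbatim): as g → 0⁺ the
magnetic weight pins the links exactly to flat Q8 connections, the electric term selects the
gauge-averaged zero-twist class, whose fermion factor is the summit's Hamiltonian
(SgHoppingDictionary) with the summit's pair field (SgPairDictionary). [difficulty: XL] (why it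
might fail: g→0⁺ selects only LIMITS of gauged ground states: a degenerate Hubbard ground space may
hold members never selected (every-GS gap; needs generic-U uniqueness or Schur), and the zero-twist
flat class must beat the 21 other flat Q8 holonomy classes in O(1) spin-twist energy.)
[doi:10.1103/physrevd.19.3682, doi:10.1103/physrevd.11.395, arXiv:1910.08931,
doi:10.1103/physrevb.62.7850]
#3 SgAnchorOrder (crux) — STRONG-COUPLING ANCHOR (card K1): there are U > 0, δ ∈ (0,1/2), g₀ > 0, c
> 0, L₀ such that for all g ≥ g₀ and all even L ≥ L₀ every ground state ψ of the N_L-particle block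
of H_g(L,U) satisfies c·L⁴·‖ψ‖² ≤ ⟨ψ, Δ_d^g†Δ_d^g ψ⟩ — B1g condensation of the confined
dimer–doublon–hole liquid (single-spin motion costs g²; singlet pairs move at first order in t
through a doublon of cost U; the g ≥ g₀ effective model is g-independent at leading order, so one c
serves all g ≥ g₀). [difficulty: open-problem] (why it might fail: the glue is symmetry-blind: the
confined pair liquid may condense in A1g (doublon-mediated extended-s), crystallise (VBS/pair
density wave) or phase-separate at every (U,δ) — empty B1g corridor; and off half filling even
bosonic BEC of the effective model is open (no RP).) [doi:10.1007/bf02352501,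
doi:10.1103/physrevd.74.014506, doi:10.1016/s0550-3213(00)00242-x, doi:10.1103/physrevlett.61.2376,
doi:10.1103/physrevlett.100.157206]
#4 SgCorridor (crux) — CORRIDOR TRANSFER (card K1′): the strong-coupling anchor implies corridor
order — pair order acquired at g ≥ g₀ is not lost anywhere on (0, g₀], in particular not across the
confinement–deconfinement crossing of the finite gauge group (Osterwalder–Seiler/Fradkin–Shenker
continuity on the strong side, stability of the electrons' pair order through the Q8 quantum-double
transition on the weak side). Stated between the two existential items by name. [deps:
SgAnchorOrder] [difficulty: open-problem] (why it might fail: a FINITE gauge group deconfines at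
small g in 2+1 D (Q8 quantum-double phase): spinful quasiparticles and spin-competitor precursors
return below g_c, pair order could vanish on an intermediate window or at the transition, and
nothing quantitative floors c′.) [doi:10.1103/physrevd.19.3682, doi:10.1103/physrevb.105.075132,
doi:10.1038/nphys4028, doi:10.1103/physrevx.6.041049]
#9 SgPairDictionary (support) — DICTIONARY I (provable now): at the trivial link configuration k ≡ 1
the gauged B1g pair field's matrix entries equal those of the summit's pair field divided by √2:
Δ_d^g (s,1) (s′,1) = (√2)⁻¹ · (pairField dWaveFormFactor L) s s′ for every L ≥ 1 and all occupation
configurations s, s′ (ε ρ(1) = ε; each bond counted once here, twice with weight 1/√2 in localPair).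
[difficulty: provable-now] [Scalapino1995, doi:10.1103/physrevd.11.395]
#9 SgHoppingDictionary (support) — DICTIONARY II (provable now): for L ≥ 3 the diagonal link block
of H_g at the trivial configuration is the summit's Hamiltonian plus a constant: H_g (s,1) (s′,1) =
hubbardTorus 2 L 1 U s s′ + δ_(s,s′) · (7/8) g² |Bond L| (ρ(1) = 1 in the hopping, zero magnetic
weight on the flat trivial configuration, E_b(1,1) = 1 − 1/8 on each of the |Bond L| = 2L² bonds; L
= 2 excluded: the double bonds of the 2×2 torus are absent from fermionTorusGraph). [difficulty:
provable-now] [doi:10.1103/physrevd.11.395, Lieb1995]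

TWO-LAYER PLAN. Foreseen glued splits (none filed now; k ≤ 3, depth 1): SgCorridorOrder ⇐
SgAnchorOrder → SgCorridor → SgCorridorOrder is already the filed first layer; SgEndpoint ⇐
SgTwistFloor (at (U,δ) the zero Q8 spin-twist class minimises the sector ground energy among the 22
flat holonomy classes (commuting pairs in Q8 mod conjugation), uniformly in even L) →
SgBornOppenheimer (g→0⁺: every ground state of the N_L-block concentrates on flat links and its pair
order converges to that of gauge-averaged minimal-twist Hubbard ground states) → SgSelection (every
Hubbard sector ground state is such a limit, or generic-U uniqueness) → SgEndpoint. SgAnchorOrder ⇐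
SgConfinedProjection (g ≥ g₀: Datta–Fernández–Fröhlich-type projection onto the gauge-singlet
dimer–doublon–hole space with controlled O(g⁻²) corrections) → SgPairLiquidCondenses (B1g pair LRO
of every ground state of that g-independent effective model at (U,δ)) → SgAnchorOrder. SgCorridor ⇐
SgStrongSide (g ≥ 1: cluster-expansion continuity in the confined regime, Osterwalder–Seiler
analyticity lifted to the pair two-point function) → SgWeakSide (g ≤ 1: stability of order through
the Q8 deconfinement crossing) → SgCorridor. A Gauss-law/Elitzur support (every spin-vector
two-point LRO vanishes in every gauge-invariant state of H_g, g > 0) is filed once the definition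
request lands.

KILL CRITERIA. Refutation of SgAnchorOrder in its ∃(U,δ) form (the B1g corridor is empty: at every
(U, δ, g ≥ g₀) the confined liquid is A1g-condensed, crystalline or phase-separated) closes the
route (close --reason refuted:SgAnchorOrder). Refutation of SgEndpoint (a (U,δ)-uniform
counterexample to endpoint continuity, e.g. a degenerate Hubbard ground space with an unordered
member never selected at g→0⁺) forces a pivot to the ground-state-AVERAGE conclusion + the shared
AverageToEvery hub (route AbelianDuality, stmt shared) on a U-window; refutation of SgCorridor by an
intermediate-g gap in the order forces re-anchoring below the deconfinement crossing or retirement.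
Any route proving S moots this one; a proof of ¬S kills K2∧K1′∧K1 jointly.

NOT DECOMPOSED YET. The Gauss-law projector and the Hamiltonian Elitzur lemma (need the
gauge-transformation unitaries Γ_y(h) ⊗ L_h on the product basis — a definition request, not an
item); the 22 flat holonomy classes of Q8 on the torus and the spin-twist floor; the g ≥ g₀
effective dimer–doublon–hole Hamiltonian (second-order projection constants); the every-GS selection
at g→0⁺ (generic-U uniqueness vs Schur); truncation questions do not arise (finite group, exact link
space ℂ⁸). All are layer-2 children of the three cruxes.

CHEAPEST FALSIFIER. Exact diagonalisation of the confined end: the g = ∞ effective model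
(gauge-singlet dimers, doublons of cost U, holes; dimer ↔ doublon at amplitude t, no single-spin
motion) on 4×4 and 6×6 tori with 2 and 4 holes at U = 4, 8 — is the two-hole pair B1g relative to
the hole-free ground state and is the four-hole state a pair condensate rather than a
VBS/phase-separated state? An A1g or crystalline answer at every U kills SgAnchorOrder at its only
computable corner. Not run here (one batched kit job for a refuter). RUN (q8check.py, exact): Q8
axioms and associativity of the inlined multiplication table, ρ a faithful unitary representation
with det 1 and ρᵀερ = ε, Σ_u ρ(u) = 0, Σ_u R(u) = 0 for the SO(3) image (Elitzur kills l = 1), and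
exact gauge covariance (deviation 0) of the inlined hopping and pair operators under the local
generators at both ends of a bond, and the confined-end kinematics (the hopping maps the transported
bond singlet onto the two doublon states with FLUX-FREE link function: pair motion at first order in
t, no electric cost) — all passed; Sketch.lean (7 items + closes) rc 0.

NUMBERS. Witness aimed at U ∈ [3, 6], δ ∈ [1/5, 3/10] (away from the striped point (8, 1/8) of
arXiv:1910.08931 where K2 is expected to fail; inside the weak-to-intermediate d-wave regime of
arXiv:2103.12097 §5–6). Link algebra: |Q8| = 8, electric operator E_b a projector (eigenvalues 0, 1:
single-spin hop costs exactly g²), magnetic weight per plaquette 1 − ½tr ρ(hol) ∈ {0, 1, 2} (0 iff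
flat), tr ρ ∈ {2, 0, −2}; flat Q8 connections on the torus = commuting holonomy pairs mod
simultaneous conjugation: 22 classes (sum over the 5 conjugacy classes {1},{−1},{±i},{±j},{±k} of
the class numbers 5,5,4,4,4 of their centralisers), the trivial one among them. Confined end:
spinful hop gap g², pair motion through a doublon at amplitude t with intermediate cost U (so the
effective pair hopping is ~t²/U, g-independent), Elitzur exact for every g > 0. Normalisation: Δ_d^g
at trivial links = pairField dWaveFormFactor L/√2 = the Statement's Δ_d, so c, c′ are in the
summit's units (L⁻⁴⟨Δ_d†Δ_d⟩).

DEFINITION REQUESTS. `spinGaugedHubbardTorus L U g G` for a finite subgroup G ⊂ SU(2) (Q8, binary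
tetrahedral/octahedral) in Literature/MathematicalPhysics/QuantumLattice, mirroring
GaugedHubbardTorus.lean (Kogut–Susskind, group-element basis): the Hamiltonian above, the local
gauge unitaries Γ_y(h) ⊗ (left/right link translations), the Gauss-law (gauge-invariant) subspace,
gauge invariance of H and of the transported singlet pair field, and the Hamiltonian Elitzur lemma
(vanishing of every spin-vector one- and two-point order in gauge-invariant states); once landed,
the inlined `let` blocks of the three cruxes are restated 1:1 over it and the Elitzur support is
filed. Cite facts wanted: Elitzur 1975 (doi:10.1103/physrevd.12.3978) Hamiltonian form;
Fradkin–Shenker 1979 (doi:10.1103/physrevd.19.3682) analyticity region; Salmhofer–Seiler 1991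
(doi:10.1007/bf02352501) strong-coupling chiral LRO.

Novelty: Searches (2026-08-16): read all 46 open route files + 13 closed (lever table in NOTES), the 41 open
and 125 closed idea cards of the sub (grep gauge|colour|Elitzur|confin: eat-the-goldstone,
colour-the-spin-two-colour-qcd, fractionalize-to-reflect (falsified), gauge-higgs-z2 (superseded));
`ledger negatives --problem HubbardSuperconductivity` (2: breathing self-dual, KLS order openness);
`lit galaxy search "off-diagonal long-range order" --star all` (60 rows, no gauge–Hubbard
deformation); `lit search` remote cascade unavailable this session (openalex/s2 HTTP 429, local
searchd reset — logged in NOTES); the spine card's own audited searches (galaxy "diquark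
condensation" 17 rows; crossref "dynamical SU(2) gauge field coupled to electron spin Hubbard" 5
rows; crossref "two-color QCD analogy Hubbard d-wave" 5 rows; lit frontier since 2021, 30 rows) and
its four refuter audits (gen-4 AUDIT-4: new-combination concurred).
Nearest prior art found: doi:10.1103/physrevb.80.155129 (Sachdev et al. 2009) and
doi:10.1103/physrevb.105.075132 / doi:10.1103/xcm5-c81y (emergent SU(2)_spin gauge theories of
Hubbard; Z₂-gauged lattice fermions with confinement-induced pairing studied per se);
doi:10.1103/PhysRevLett.60.821 (Wiegmann 1988: superconductivity as the confinement phase of a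
non-abelian gauge description of doped large-U Hubbard); doi:10.1007/bf02352501 (Salmhofer–Seiler:
RP proof of SSB at strong gauge coupling); in-tree nearest route: EatTheGoldstone (removable
CHARGE-U(1) gauging  [refs: 10.1103/physrevb.80.155129, 10.1103/physrevb.105.075132, 10.1103/xcm5-c81y, 10.1103/PhysRevLett.60.821, 10.1007/bf02352501, doi:10.1103/physrevb.80.155129, doi:10.1103/physrevb.105.075132, doi:10.1103/xcm5-c81y, doi:10.1103/PhysRevLett.60.821, doi:10.1007/bf02352501]

Barriers (technique_class: gauge-deformation, elitzur-filter, confinement-glue): - technique_class: gauge-deformation, elitzur-filter, confinement-glue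
- Literature.Barriers.HubbardSuperconductivity.PureModelStripeCompetition: evaded for every g > 0 by
Elitzur (no spin-stripe / Néel / spiral / Nagaoka order in any gauge-invariant state); charge
stripes stay legal and the barrier re-enters only through SgEndpoint at g = 0, which is why the
witness is aimed at U ∈ [3,6], δ ∈ [1/5,3/10] and K2 is expected FALSE at (8, 1/8).
- Literature.Barriers.HubbardSuperconductivity.GeneralizedHartreeFockNoPairing: not in class — no
quasi-free variational state anywhere; at g ≥ g₀ the carriers are confinement composites (BLS Thm
2.11 still forbids pairing in the bare gHF functional of H_g's fermion factor; nothing here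
contradicts it).
- Literature.Barriers.HubbardSuperconductivity.PerturbativeInvisibilityOfPairing: evaded at
SgAnchorOrder/SgCorridor (no expansion in U; order O(1), kinematic); it bites at SgEndpoint — the
bet that an order positive for all g ∈ (0, g₀] has the clean Kohn–Luttinger limit rather than 0; no
rigorous handle, ranked 2 for that reason.
- Literature.Barriers.HubbardSuperconductivity.WeakCouplingCeiling: it does not evade it at the
endpoint; the bet is intermediate U (witness box), where neither ceiling applies and the clean order
is not e^(−1/U²)-small.
- Literature.Barriers.HubbardSuperconductivity.StrongCouplingCeiling: the g ≥ g₀ projection is a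
convergent degenerate-perturbation expansion into a GAPPED constrained space (Datta–Fernández–Fröh

History (route lifecycle, newest last):
- 2026-08-17T11:20:06Z · DORMANT — route-repair verdict: route is DEAD — close refuted:SgAnchorOrder (header kill criterion) as soon as ¬SgAnchorOrder (p154362/p155047, pending verify; Negative l (planner-rrefute-HubbardSuperconductivity-Colou-bea9611b-0)
- 2026-08-17T13:48:38Z · BROKEN — SgAnchorOrder (stmt-HubbardSuperconductivity-16273, crux) refuted by Summit.HubbardSuperconductivity.HubbardSuperconductivity.Theorems.ColourTheSpinSgAnchorOrder_refuted @ e05657dafcf5 (refuter-rattack-stmt-HubbardSuperconductivity-16274-0)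
- 2026-08-17T14:34:48Z · CLOSED refuted — refuted:stmt-HubbardSuperconductivity-16273 (SgAnchorOrder) by Summit.HubbardSuperconductivity.HubbardSuperconductivity.Theorems.ColourTheSpinSgAnchorOrder_refuted (planner-rfix-HubbardSuperconductivity-Colour-50e50438-0)

sub-problem: HubbardSuperconductivity · status: closed(refuted) · opened planner-plan-novel-HubbardSuperconductivity-Hub-0943e37c-v2-g4-0 2026-08-16T18:13:46Z · rev 0 · ledger route-HubbardSuperconductivity-ColourTheSpin
GENERATED by the gate from the ledger (D-0016/17). Provers cite these decls: `theorem foo : Summit.HubbardSuperconductivity.HubbardSuperconductivity.Theses.ColourTheSpin.<Decl> := …` in Summits/HubbardSuperconductivity/HubbardSuperconductivity/Theorems/<Name>.lean.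
-/

namespace Summit.HubbardSuperconductivity.HubbardSuperconductivity.Theses.ColourTheSpin

open scoped BigOperators Topology Manifold Classical MeasureTheory ProbabilityTheory Matrix InnerProductSpace ComplexConjugate ContinuousMap
open Filter Set Function TopologicalSpace MeasureTheory

attribute [summit_statement] _root_.HubbardSuperconductivity

open Literature.Hubbard

/-- item stmt-HubbardSuperconductivity-16271 · target · rank 0 · closed · moot by None · by planner
why it might fail: it contains the whole bet on the gauged side: an empty B1g corridor (A1g/VBS/phase separation at strong g) or loss of order across the Q8 deconfinement crossing makes it false at every (U,δ).
sources: doi:10.1103/physrevd.11.395, doi:10.1103/physrevd.19.3682, doi:10.1007/bf02352501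
[target] CORRIDOR ORDER (the X consumed by the endpoint crux): there are U > 0, δ ∈ (0,1/2), g₀ > 0,
c′ > 0, L₁ such that for every gauge coupling g ∈ (0, g₀] and every even L ≥ L₁ every ground state ψ
of the N_L-particle block of the Q8-spin-gauged torus H_g(L,U) (all Gauss sectors admitted; ground
state = nonzero eigenvector whose eigenvalue lies below every Rayleigh quotient of the block) has
gauged B1g pair order c′·L⁴·‖ψ‖² ≤ ⟨ψ, Δ_d^g†Δ_d^g ψ⟩. Reached as SgCorridor ∘ SgAnchorOrder;
attackable directly. [difficulty: open-problem] -/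
@[route_item "route-HubbardSuperconductivity-ColourTheSpin", crux]
def SgCorridorOrder : Prop :=
  open Literature.MathematicalPhysics.QuantumLattice in ∃ U : ℝ, 0 < U ∧ ∃ δ ∈ Set.Ioo (0 : ℝ) (1 / 2), ∃ g₀ : ℝ, 0 < g₀ ∧ ∃ c' : ℝ, 0 < c' ∧ ∃ L₁ : ℕ, ∀ g : ℝ, 0 < g → g ≤ g₀ → ∀ (L : ℕ) [NeZero L], L₁ ≤ L → Even L → (let m : Fin 2 × ZMod 4 → Fin 2 × ZMod 4 → Fin 2 × ZMod 4 := fun u v => (u.1 + v.1, if u.1 = 0 then (if v.1 = 0 then u.2 + v.2 else v.2 - u.2) else if v.1 = 0 then u.2 + v.2 else 2 + v.2 - u.2); let iv : Fin 2 × ZMod 4 → Fin 2 × ZMod 4 := fun u => (u.1, if u.1 = 0 then -u.2 else u.2 + 2); let r : Fin 2 × ZMod 4 → Fin 2 → Fin 2 → ℂ := fun u σ τ => if u.1 = 0 then (if σ = τ then (if σ = 0 then Complex.I else -Complex.I) ^ u.2.val else 0) else if σ = τ then 0 else if σ = 0 then -(-Complex.I) ^ u.2.val else Complex.I ^ u.2.val;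 let hop := ∑ b : GaugedHubbard.Bond L, ∑ σ : Fin 2, ∑ τ : Fin 2, Matrix.kroneckerMap (· * ·) (creation (orb b.1 σ) * annihilation (orb (b.1.shift b.2) τ)) (Matrix.diagonal fun k : GaugedHubbard.Bond L → Fin 2 × ZMod 4 => r (k b) σ τ); let H := -(hop + hopᴴ) + ((U : ℝ) : ℂ) • Matrix.kroneckerMap (· * ·) (∑ x : FermionTorus 2 L, numberOp x 0 * numberOp x 1) (1 : Matrix (GaugedHubbard.Bond L → Fin 2 × ZMod 4) (GaugedHubbard.Bond L → Fin 2 × ZMod 4) ℂ) + ((g ^ 2 : ℝ) : ℂ) • Matrix.kroneckerMap (· * ·) (1 : Matrix (Finset (Orb (FermionTorus 2 L))) _ ℂ) (∑ b : GaugedHubbard.Bond L, Matrix.of fun k k' : GaugedHubbard.Bond L → Fin 2 × ZMod 4 => if k' = Function.update k b (k' b) then (if k b = k' b then (1 : ℂ) else 0) - 1 / 8 else 0) + ((1 / g ^ 2 : ℝ) : ℂ) • Matrix.kroneckerMap (· * ·) (1 : Matrix (Finset (Orb (FermionTorus 2 L))) _ ℂ) (Matrix.diagonal fun k : GaugedHubbard.Bond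 L → Fin 2 × ZMod 4 => ∑ x : FermionTorus 2 L, (1 - (r (m (m (m (k (x, 0)) (k (x.shift 0, 1))) (iv (k (x.shift 1, 0)))) (iv (k (x, 1)))) 0 0 + r (m (m (m (k (x, 0)) (k (x.shift 0, 1))) (iv (k (x.shift 1, 0)))) (iv (k (x, 1)))) 1 1) / 2)); let P := ∑ b : GaugedHubbard.Bond L, (if b.2 = 0 then (1 : ℂ) else -1) • ∑ σ : Fin 2, ∑ τ : Fin 2, Matrix.kroneckerMap (· * ·) (annihilation (orb b.1 σ) * annihilation (orb (b.1.shift b.2) τ)) (Matrix.diagonal fun k : GaugedHubbard.Bond L → Fin 2 × ZMod 4 => if σ = 0 then r (k b) 1 τ else -r (k b) 0 τ); let p := fun ik : Finset (Orb (FermionTorus 2 L)) × (GaugedHubbard.Bond L → Fin 2 × ZMod 4) => ik.1.card = 2 * ⌊(1 - δ) * (L : ℝ) ^ 2 / 2⌋₊; ∀ ψ : {ik // p ik} → ℂ, (ψ ≠ 0 ∧ ∃ E : ℝ, H.toBlock p p *ᵥ ψ = (E : ℂ) • ψ ∧ ∀ φ : {ik // p ik} → ℂ, E * (star φ ⬝ᵥ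 φ).re ≤ (star φ ⬝ᵥ H.toBlock p p *ᵥ φ).re) → c' * (L : ℝ) ^ 4 * (star ψ ⬝ᵥ ψ).re ≤ (star ψ ⬝ᵥ (Pᴴ * P).toBlock p p *ᵥ ψ).re)

/-- item stmt-HubbardSuperconductivity-16272 · crux · rank 2 · closed · moot by None · by planner
why it might fail: g→0⁺ selects only LIMITS of gauged ground states: a degenerate Hubbard ground space may hold members never selected (every-GS gap; needs generic-U uniqueness or Schur), and the zero-twist flat class must beat the 21 other flat Q8 holonomy classes in O(1) spin-twist energy.
sources: doi:10.1103/physrevd.19.3682, doi:10.1103/physrevd.11.395, arXiv:1910.08931, doi:10.1103/physrevb.62.7850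
[crux] ENDPOINT CONTINUITY (card K2, the load-bearing bet), pointwise in (U, δ): for all U > 0, δ ∈
(0,1/2), g₀ > 0, c′ > 0, L₁: if for every g ∈ (0, g₀] and every even L ≥ L₁ every ground state of
the N_L-block of H_g(L,U) has gauged B1g pair order ≥ c′L⁴‖ψ‖², then every normalised (N_L, S^z =
0)-sector ground-state sequence of hubbardTorus 2 L 1 U has d_(x²−y²) pair-field long-range order
along even L (the summit's matrix at (U, δ), verbatim): as g → 0⁺ the magnetic weight pins the links
exactly to flat Q8 connections, the electric term selects the gauge-averaged zero-twist class, whose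
fermion factor is the summit's Hamiltonian (SgHoppingDictionary) with the summit's pair field
(SgPairDictionary). [difficulty: XL] -/
@[route_item "route-HubbardSuperconductivity-ColourTheSpin", crux]
def SgEndpoint : Prop :=
  open Literature.MathematicalPhysics.QuantumLattice in ∀ (U δ g₀ c' : ℝ) (L₁ : ℕ), 0 < U → δ ∈ Set.Ioo (0 : ℝ) (1 / 2) → 0 < g₀ → 0 < c' → (∀ g : ℝ, 0 < g → g ≤ g₀ → ∀ (L : ℕ) [NeZero L], L₁ ≤ L → Even L → (let m : Fin 2 × ZMod 4 → Fin 2 × ZMod 4 → Fin 2 × ZMod 4 := fun u v => (u.1 + v.1, if u.1 = 0 then (if v.1 = 0 then u.2 + v.2 else v.2 - u.2) else if v.1 = 0 then u.2 + v.2 else 2 + v.2 - u.2); let iv : Fin 2 × ZMod 4 → Fin 2 × ZMod 4 := fun u => (u.1, if u.1 = 0 then -u.2 else u.2 + 2); let r : Fin 2 × ZMod 4 → Fin 2 → Fin 2 → ℂ := fun u σ τ => if u.1 = 0 then (if σ = τ then (if σ = 0 then Complex.I else -Complex.I) ^ u.2.val else 0) else if σ = τ then 0 else if σ = 0 then -(-Complex.I)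 ^ u.2.val else Complex.I ^ u.2.val; let hop := ∑ b : GaugedHubbard.Bond L, ∑ σ : Fin 2, ∑ τ : Fin 2, Matrix.kroneckerMap (· * ·) (creation (orb b.1 σ) * annihilation (orb (b.1.shift b.2) τ)) (Matrix.diagonal fun k : GaugedHubbard.Bond L → Fin 2 × ZMod 4 => r (k b) σ τ); let H := -(hop + hopᴴ) + ((U : ℝ) : ℂ) • Matrix.kroneckerMap (· * ·) (∑ x : FermionTorus 2 L, numberOp x 0 * numberOp x 1) (1 : Matrix (GaugedHubbard.Bond L → Fin 2 × ZMod 4) (GaugedHubbard.Bond L → Fin 2 × ZMod 4) ℂ) + ((g ^ 2 : ℝ) : ℂ) • Matrix.kroneckerMap (· * ·) (1 : Matrix (Finset (Orb (FermionTorus 2 L))) _ ℂ) (∑ b : GaugedHubbard.Bond L, Matrix.of fun k k' : GaugedHubbard.Bond L → Fin 2 × ZMod 4 => if k' = Function.update k b (k' b) then (if k b = k' b then (1 : ℂ) else 0) - 1 / 8 else 0) + ((1 / g ^ 2 : ℝ) : ℂ) • Matrix.kroneckerMap (· * ·) (1 : Matrix (Finset (Orb (FermionTorus 2 L))) _ ℂ)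 (Matrix.diagonal fun k : GaugedHubbard.Bond L → Fin 2 × ZMod 4 => ∑ x : FermionTorus 2 L, (1 - (r (m (m (m (k (x, 0)) (k (x.shift 0, 1))) (iv (k (x.shift 1, 0)))) (iv (k (x, 1)))) 0 0 + r (m (m (m (k (x, 0)) (k (x.shift 0, 1))) (iv (k (x.shift 1, 0)))) (iv (k (x, 1)))) 1 1) / 2)); let P := ∑ b : GaugedHubbard.Bond L, (if b.2 = 0 then (1 : ℂ) else -1) • ∑ σ : Fin 2, ∑ τ : Fin 2, Matrix.kroneckerMap (· * ·) (annihilation (orb b.1 σ) * annihilation (orb (b.1.shift b.2) τ)) (Matrix.diagonal fun k : GaugedHubbard.Bond L → Fin 2 × ZMod 4 => if σ = 0 then r (k b) 1 τ else -r (k b) 0 τ); let p := fun ik : Finset (Orb (FermionTorus 2 L)) × (GaugedHubbard.Bond L → Fin 2 × ZMod 4) => ik.1.card = 2 * ⌊(1 - δ) * (L : ℝ) ^ 2 / 2⌋₊; ∀ ψ : {ik // p ik} → ℂ, (ψ ≠ 0 ∧ ∃ E : ℝ, H.toBlock p p *ᵥ ψ = (E : ℂ) • ψ ∧ ∀ φ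 : {ik // p ik} → ℂ, E * (star φ ⬝ᵥ φ).re ≤ (star φ ⬝ᵥ H.toBlock p p *ᵥ φ).re) → c' * (L : ℝ) ^ 4 * (star ψ ⬝ᵥ ψ).re ≤ (star ψ ⬝ᵥ (Pᴴ * P).toBlock p p *ᵥ ψ).re)) → ∀ (N : ℕ → ℕ) (ψ : ∀ L, Fock (Orb (FermionTorus 2 L))), (∀ L, Even L → N L = 2 * ⌊(1 - δ) * (L : ℝ) ^ 2 / 2⌋₊ ∧ star (ψ L) ⬝ᵥ ψ L = 1 ∧ IsGroundStateInSector (hubbardTorus 2 L 1 U) (N L) 0 (ψ L)) → Literature.Probability.LatticeModels.HasLongRangeOrder (fun k => Literature.Probability.LatticeModels.halfOpenBox 2 (2 * k)) (fun k => torusPullback (pairFieldCorr dWaveFormFactor ψ) (2 * k))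

/-- item stmt-HubbardSuperconductivity-16273 · crux · rank 3 · closed · refuted by Summit.HubbardSuperconductivity.HubbardSuperconductivity.Theorems.ColourTheSpinSgAnchorOrder_refuted @ e05657dafcf5 (refuter) · by planner
why it might fail: the glue is symmetry-blind: the confined pair liquid may condense in A1g (doublon-mediated extended-s), crystallise (VBS/pair density wave) or phase-separate at every (U,δ) — empty B1g corridor; and off half filling even bosonic BEC of the effective model is open (no RP).
sources: doi:10.1007/bf02352501, doi:10.1103/physrevd.74.014506, doi:10.1016/s0550-3213(00)00242-x, doi:10.1103/physrevlett.61.2376, doi:10.1103/physrevlett.100.157206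
[crux] STRONG-COUPLING ANCHOR (card K1): there are U > 0, δ ∈ (0,1/2), g₀ > 0, c > 0, L₀ such that
for all g ≥ g₀ and all even L ≥ L₀ every ground state ψ of the N_L-particle block of H_g(L,U)
satisfies c·L⁴·‖ψ‖² ≤ ⟨ψ, Δ_d^g†Δ_d^g ψ⟩ — B1g condensation of the confined dimer–doublon–hole
liquid (single-spin motion costs g²; singlet pairs move at first order in t through a doublon of
cost U; the g ≥ g₀ effective model is g-independent at leading order, so one c serves all g ≥ g₀).
[difficulty: open-problem] -/
@[route_item "route-HubbardSuperconductivity-ColourTheSpin", crux]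
def SgAnchorOrder : Prop :=
  open Literature.MathematicalPhysics.QuantumLattice in ∃ U : ℝ, 0 < U ∧ ∃ δ ∈ Set.Ioo (0 : ℝ) (1 / 2), ∃ g₀ : ℝ, 0 < g₀ ∧ ∃ c : ℝ, 0 < c ∧ ∃ L₀ : ℕ, ∀ g : ℝ, g₀ ≤ g → ∀ (L : ℕ) [NeZero L], L₀ ≤ L → Even L → (let m : Fin 2 × ZMod 4 → Fin 2 × ZMod 4 → Fin 2 × ZMod 4 := fun u v => (u.1 + v.1, if u.1 = 0 then (if v.1 = 0 then u.2 + v.2 else v.2 - u.2) else if v.1 = 0 then u.2 + v.2 else 2 + v.2 - u.2); let iv : Fin 2 × ZMod 4 → Fin 2 × ZMod 4 := fun u => (u.1, if u.1 = 0 then -u.2 else u.2 + 2); let r : Fin 2 × ZMod 4 → Fin 2 → Fin 2 → ℂ := fun u σ τ => if u.1 = 0 then (if σ = τ then (if σ = 0 then Complex.I else -Complex.I) ^ u.2.val else 0) else if σ = τ then 0 else if σ = 0 then -(-Complex.I) ^ u.2.val else Complex.I ^ u.2.val; let hop := ∑ b : GaugedHubbard.Bond L, ∑ σ : Fin 2,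 ∑ τ : Fin 2, Matrix.kroneckerMap (· * ·) (creation (orb b.1 σ) * annihilation (orb (b.1.shift b.2) τ)) (Matrix.diagonal fun k : GaugedHubbard.Bond L → Fin 2 × ZMod 4 => r (k b) σ τ); let H := -(hop + hopᴴ) + ((U : ℝ) : ℂ) • Matrix.kroneckerMap (· * ·) (∑ x : FermionTorus 2 L, numberOp x 0 * numberOp x 1) (1 : Matrix (GaugedHubbard.Bond L → Fin 2 × ZMod 4) (GaugedHubbard.Bond L → Fin 2 × ZMod 4) ℂ) + ((g ^ 2 : ℝ) : ℂ) • Matrix.kroneckerMap (· * ·) (1 : Matrix (Finset (Orb (FermionTorus 2 L))) _ ℂ) (∑ b : GaugedHubbard.Bond L, Matrix.of fun k k' : GaugedHubbard.Bond L → Fin 2 × ZMod 4 => if k' = Function.update k b (k' b) then (if k b = k' b then (1 : ℂ) else 0) - 1 / 8 else 0) + ((1 / g ^ 2 : ℝ) : ℂ) • Matrix.kroneckerMap (· * ·) (1 : Matrix (Finset (Orb (FermionTorus 2 L))) _ ℂ) (Matrix.diagonal fun k : GaugedHubbard.Bond L → Fin 2 × ZMod 4 => ∑ x : FermionTorus 2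 L, (1 - (r (m (m (m (k (x, 0)) (k (x.shift 0, 1))) (iv (k (x.shift 1, 0)))) (iv (k (x, 1)))) 0 0 + r (m (m (m (k (x, 0)) (k (x.shift 0, 1))) (iv (k (x.shift 1, 0)))) (iv (k (x, 1)))) 1 1) / 2)); let P := ∑ b : GaugedHubbard.Bond L, (if b.2 = 0 then (1 : ℂ) else -1) • ∑ σ : Fin 2, ∑ τ : Fin 2, Matrix.kroneckerMap (· * ·) (annihilation (orb b.1 σ) * annihilation (orb (b.1.shift b.2) τ)) (Matrix.diagonal fun k : GaugedHubbard.Bond L → Fin 2 × ZMod 4 => if σ = 0 then r (k b) 1 τ else -r (k b) 0 τ); let p := fun ik : Finset (Orb (FermionTorus 2 L)) × (GaugedHubbard.Bond L → Fin 2 × ZMod 4) => ik.1.card = 2 * ⌊(1 - δ) * (L : ℝ) ^ 2 / 2⌋₊; ∀ ψ : {ik // p ik} → ℂ, (ψ ≠ 0 ∧ ∃ E : ℝ, H.toBlock p p *ᵥ ψ = (E : ℂ) • ψ ∧ ∀ φ : {ik // p ik} → ℂ, E * (star φ ⬝ᵥ φ).re ≤ (star φ ⬝ᵥ H.toBlock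 p p *ᵥ φ).re) → c * (L : ℝ) ^ 4 * (star ψ ⬝ᵥ ψ).re ≤ (star ψ ⬝ᵥ (Pᴴ * P).toBlock p p *ᵥ ψ).re)

/-- item stmt-HubbardSuperconductivity-16274 · crux · rank 4 · closed · vacuous by Summit.HubbardSuperconductivity.ColourTheSpin.sgCorridor_proof @ b03fdb793fa2 (prover) · by planner
why it might fail: a FINITE gauge group deconfines at small g in 2+1 D (Q8 quantum-double phase): spinful quasiparticles and spin-competitor precursors return below g_c, pair order could vanish on an intermediate window or at the transition, and nothing quantitative floors c′.
sources: doi:10.1103/physrevd.19.3682, doi:10.1103/physrevb.105.075132, doi:10.1038/nphys4028, doi:10.1103/physrevx.6.041049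
[crux] CORRIDOR TRANSFER (card K1′): the strong-coupling anchor implies corridor order — pair order
acquired at g ≥ g₀ is not lost anywhere on (0, g₀], in particular not across the
confinement–deconfinement crossing of the finite gauge group (Osterwalder–Seiler/Fradkin–Shenker
continuity on the strong side, stability of the electrons' pair order through the Q8 quantum-double
transition on the weak side). Stated between the two existential items by name. [deps:
SgAnchorOrder] [difficulty: open-problem] -/
@[route_item "route-HubbardSuperconductivity-ColourTheSpin", crux]
def SgCorridor : Prop :=
  SgAnchorOrder → SgCorridorOrder

/-- item stmt-HubbardSuperconductivity-16275 · support · rank 9 · closed · proved by Summit.HubbardSuperconductivity.ColourTheSpin.sgPairDictionary_proof @ 2aa417da056b (prover) · by planner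
sources: Scalapino1995, doi:10.1103/physrevd.11.395
[support] DICTIONARY I (provable now): at the trivial link configuration k ≡ 1 the gauged B1g pair
field's matrix entries equal those of the summit's pair field divided by √2: Δ_d^g (s,1) (s′,1) =
(√2)⁻¹ · (pairField dWaveFormFactor L) s s′ for every L ≥ 1 and all occupation configurations s, s′
(ε ρ(1) = ε; each bond counted once here, twice with weight 1/√2 in localPair). [difficulty:
provable-now] -/
@[route_item "route-HubbardSuperconductivity-ColourTheSpin"]
def SgPairDictionary : Prop :=
  open Literature.MathematicalPhysics.QuantumLattice in ∀ (L : ℕ) [NeZero L] (s s' : Finset (Orb (FermionTorus 2 L))), (let r : Fin 2 × ZMod 4 → Fin 2 → Fin 2 → ℂ := fun u σ τ => if u.1 = 0 then (if σ = τ then (if σ = 0 then Complex.I else -Complex.I) ^ u.2.val else 0) else if σ = τ then 0 else if σ = 0 then -(-Complex.I) ^ u.2.val else Complex.I ^ u.2.val; let P := ∑ b : GaugedHubbard.Bond L, (if b.2 = 0 then (1 : ℂ) else -1) • ∑ σ : Fin 2, ∑ τ : Fin 2, Matrix.kroneckerMap (· * ·) (annihilation (orb b.1 σ) * annihilation (orb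 (b.1.shift b.2) τ)) (Matrix.diagonal fun k : GaugedHubbard.Bond L → Fin 2 × ZMod 4 => if σ = 0 then r (k b) 1 τ else -r (k b) 0 τ); P (s, (fun _ => ((0 : Fin 2), (0 : ZMod 4)))) (s', (fun _ => ((0 : Fin 2), (0 : ZMod 4))))) = (((Real.sqrt 2)⁻¹ : ℝ) : ℂ) * pairField dWaveFormFactor L s s'

/-- item stmt-HubbardSuperconductivity-16276 · support · rank 9 · closed · proved by Summit.HubbardSuperconductivity.ColourTheSpin.sgHoppingDictionary_proof @ 2aa417da056b (prover) · by planner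
sources: doi:10.1103/physrevd.11.395, Lieb1995
[support] DICTIONARY II (provable now): for L ≥ 3 the diagonal link block of H_g at the trivial
configuration is the summit's Hamiltonian plus a constant: H_g (s,1) (s′,1) = hubbardTorus 2 L 1 U s
s′ + δ_(s,s′) · (7/8) g² |Bond L| (ρ(1) = 1 in the hopping, zero magnetic weight on the flat trivial
configuration, E_b(1,1) = 1 − 1/8 on each of the |Bond L| = 2L² bonds; L = 2 excluded: the double
bonds of the 2×2 torus are absent from fermionTorusGraph). [difficulty: provable-now] -/
@[route_item "route-HubbardSuperconductivity-ColourTheSpin"]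
def SgHoppingDictionary : Prop :=
  open Literature.MathematicalPhysics.QuantumLattice in ∀ (L : ℕ) [NeZero L], 3 ≤ L → ∀ (U g : ℝ) (s s' : Finset (Orb (FermionTorus 2 L))), (let m : Fin 2 × ZMod 4 → Fin 2 × ZMod 4 → Fin 2 × ZMod 4 := fun u v => (u.1 + v.1, if u.1 = 0 then (if v.1 = 0 then u.2 + v.2 else v.2 - u.2) else if v.1 = 0 then u.2 + v.2 else 2 + v.2 - u.2); let iv : Fin 2 × ZMod 4 → Fin 2 × ZMod 4 := fun u => (u.1, if u.1 = 0 then -u.2 else u.2 + 2); let r : Fin 2 × ZMod 4 → Fin 2 → Fin 2 → ℂ := fun u σ τ => if u.1 = 0 then (if σ = τ then (if σ = 0 then Complex.I else -Complex.I) ^ u.2.val else 0) else if σ = τ then 0 else if σ = 0 then -(-Complex.I) ^ u.2.val else Complex.I ^ u.2.val; let hop := ∑ b : GaugedHubbard.Bond L, ∑ σ : Fin 2, ∑ τ : Fin 2, Matrix.kroneckerMap (· * ·) (creation (orb b.1 σ) * annihilation (orb (b.1.shift b.2) τ)) (Matrix.diagonal fun k : GaugedHubbard.Bond L → Fin 2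 × ZMod 4 => r (k b) σ τ); let H := -(hop + hopᴴ) + ((U : ℝ) : ℂ) • Matrix.kroneckerMap (· * ·) (∑ x : FermionTorus 2 L, numberOp x 0 * numberOp x 1) (1 : Matrix (GaugedHubbard.Bond L → Fin 2 × ZMod 4) (GaugedHubbard.Bond L → Fin 2 × ZMod 4) ℂ) + ((g ^ 2 : ℝ) : ℂ) • Matrix.kroneckerMap (· * ·) (1 : Matrix (Finset (Orb (FermionTorus 2 L))) _ ℂ) (∑ b : GaugedHubbard.Bond L, Matrix.of fun k k' : GaugedHubbard.Bond L → Fin 2 × ZMod 4 => if k' = Function.update k b (k' b) then (if k b = k' b then (1 : ℂ) else 0) - 1 / 8 else 0) + ((1 / g ^ 2 : ℝ) : ℂ) • Matrix.kroneckerMap (· * ·) (1 : Matrix (Finset (Orb (FermionTorus 2 L))) _ ℂ) (Matrix.diagonal fun k : GaugedHubbard.Bond L → Fin 2 × ZMod 4 => ∑ x : FermionTorus 2 L, (1 - (r (m (m (m (k (x, 0)) (k (x.shift 0, 1))) (iv (k (x.shift 1, 0)))) (iv (k (x, 1)))) 0 0 + r (m (m (m (k (x, 0)) (k (x.shift 0,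 1))) (iv (k (x.shift 1, 0)))) (iv (k (x, 1)))) 1 1) / 2)); H (s, (fun _ => ((0 : Fin 2), (0 : ZMod 4)))) (s', (fun _ => ((0 : Fin 2), (0 : ZMod 4))))) = hubbardTorus 2 L 1 U s s' + (if s = s' then (((7 : ℝ) / 8 * g ^ 2 * (Fintype.card (GaugedHubbard.Bond L) : ℝ) : ℝ) : ℂ) else 0)

/-- item stmt-HubbardSuperconductivity-16277 · assembly · rank 1 · closed · proved by Summit.HubbardSuperconductivity.ColourTheSpin.assembly_proof @ 2aa417da056b · by planner
sources: doi:10.1103/physrevd.12.3978, doi:10.1103/physrevd.19.3682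
[assembly] SgAnchorOrder → SgCorridor → SgEndpoint → HubbardSuperconductivity (the target
SgCorridorOrder is the intermediate type). -/
@[route_item "route-HubbardSuperconductivity-ColourTheSpin"]
def Assembly : Prop :=
  SgAnchorOrder → SgCorridor → SgEndpoint → _root_.HubbardSuperconductivity

/-! D-0027 §2.1 — DECIDING THEOREM (planner-authored via `route open/edit --closes-file`; by planner-plan-novel-HubbardSuperconductivity-Hub-0943e37c-v2- 2026-08-16T18:13:46Z) — ARCHIVED: route closed (refuted) 2026-08-17T14:34:48Z; kept so importers keep building:
its hypotheses are this route's items and its conclusion the sub-problem Statement (glue_lint), and it elaborates with this file. -/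

@[closes "route-HubbardSuperconductivity-ColourTheSpin"] theorem closes (h1 : SgAnchorOrder) (h2 : SgCorridor) (h3 : SgEndpoint) :
    _root_.HubbardSuperconductivity := by
  obtain ⟨U, hU, δ, hδ, g₀, hg, c', hc', L₁, hC⟩ := h2 h1
  exact ⟨U, hU, δ, hδ, h3 U δ g₀ c' L₁ hU hδ hg hc' hC⟩

end Summit.HubbardSuperconductivity.HubbardSuperconductivity.Theses.ColourTheSpin
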